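import Summits.Ventures.CertifiedManyBodySolver.Theorems.M3x2EdgeSplitSymReplaySyntaxV

/-!
# SymReplay checker — `fillSlack` / `fillAntiH` (T13′/T14′ of hub-lb-crit-1 V93/V94; DRAFT by hub-lb-dual-eng-3 g2, 0 kit)

Additive, COMPUTABLE pre-processing over the landed checker (T1 `…SymReplaySyntax` + `…SyntaxV`); no theorem of the
soundness chain (T2–T11) is touched or needed: `energyDensity_ge_symValue (K) (hK : symCheck K = true)` (T10)
quantifies over ALL `SymCert`s, so a data module may ship a certificate `K₀` WITHOUT its `slack` and `antiH` slots,
let the kernel/compiler COMPUTE them (`fillCert K₀`), and close with `symCheckV (fillCert K₀) = true := by native_decide`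
+ `symCheck_of_symCheckV` + T10 applied to `fillCert K₀` verbatim.  What is computed:
* `residualV K` — the collected, canonicalised residual of the identity `LHS − RHS(K)`, i.e. exactly the polynomial
  that `identityOKV K` tests for zero (same pipeline: `collect ∘ nfPoly`, then `canonTermAV (minCornerP frame)` when
  `useCanon`, then `collect`), with zero coefficients pruned;
* `fillAntiH K₀` — for the residual `R` of `K₀` (slack and antiH emptied) and its canonical adjoint image
  `R† := pipeline (padj R)`, the anti-Hermitian slot `antiH := [ (b_w / 2) • ([1 • w]) | (b_w, w) ∈ R† ]` (the RHS gains
  `d (w† − w)`, the residual `LHS − RHS` loses it); for an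
  adjoint pair `{v, v'}` with `canon(nf v†) = σ v'` this leaves the residual `(a_v + σ a_{v'})/2` on BOTH words
  (total price `|a_v + σ a_{v'}|`, the converter's folding rule — sym-eng-1 symcert-v0 README — now inside Lean) and
  kills sign-odd self-adjoint words exactly;
* `fillSlack K` — `slack :=` the residual of `K` with its slack emptied (so the identity closes iff `nfPoly`/`canonAV`
  are idempotent on the collected canonical words — true by construction for normal-ordered anchored words; a word on
  which they are not simply makes `symCheckV` fail, never unsound);
* `fillCert K₀ := ` both, sharing the one expensive residual pass (the Gram pair products) and deriving the final
  slack from `R`, `R†` by one more CHEAP pass (linearity + idempotence of the pipeline), so the closing `native_decide`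
  costs ≈ 2× `identityOKV` (fill pass + check pass).
BYTES (hub-lb-dual-eng-3 E1-BYTES, STATUS 2026-08-28 l.1386): the two slots this removes from the SHIPPED data are
74 % of rung V (v0′: 6.62 → 2.56 MB) and ≈ 500 of ≈ 650 MB of an E₁-class object in the token grammar.
No summit statement is proved here; no certificate is landed by this file; nothing here predicts superconductivity.
-/

namespace Summit.Ventures.CertifiedManyBodySolver.Theorems.SymReplay

open Literature.Probability.LatticeModels (Site)

section Fill

/-- Drop the terms with coefficient `0`. -/
def pruneZ (p : QPoly) : QPoly := p.filter fun t => !decide (t.1 = 0)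

/-- The executed identity pipeline of `identityOKV` applied to an arbitrary polynomial `p` in the frame of `K`:
normal-order, collect, canonicalise each term by the anchored affine-`D₄` canonicaliser (when `K.useCanon`),
collect again, prune zeros.  `identityOKV K = true ↔ canonPipeV K (psub (lhsPoly K) (rhsPoly K)) = []` up to
zero-coefficient terms. -/
def canonPipeV (K : SymCert) (p : QPoly) : QPoly :=
  let N := collect (nfPoly p)
  let cP := minCornerP K.frame
  pruneZ (collect (if K.useCanon then N.flatMap (canonTermAV cP K.frame) else N))

/-- **The residual** of the certificate identity for `K` as given (all slots, slack included): the collected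
canonical polynomial `LHS − RHS(K)`; `K` passes `identityOKV` iff this is `[]`. -/
def residualV (K : SymCert) : QPoly := canonPipeV K (psub (lhsPoly K) (rhsPoly K))

/-- The word polynomial of an `antiH` slot (as in `rhsPoly`): `Σ d • (V† − V)`. -/
def antiHPoly (A : List (ℚ × QPoly)) : QPoly := A.flatMap fun t => pscale t.1 (psub (padj t.2) t.2)

/-- **T13′ `fillSlack`**: replace the slack slot by the residual of `K` computed with the slack slot EMPTIED
(coefficients as they stand: `LHS − RHS₀ = R` ⇒ `LHS − (RHS₀ + R) = 0`).  Price in `symValue` = `Σ |a_w|` over the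
computed residual. -/
def fillSlack (K : SymCert) : SymCert :=
  { K with slack := residualV { K with slack := [] } }

/-- **T14′ `fillAntiH`**: empty `slack` and `antiH`, compute the residual `R` and its canonical adjoint image
`R† = pipeline (padj R)`, and set `antiH := [(b/2) • [(1, w)] | (b, w) ∈ R†]` (uniform rule: for an adjoint pair
`{v, v'}`, `canon (nf v†) = σ v'`, the new residual is `(a_v + σ a_{v'})/2` on each; a self-adjoint word with
`σ = −1` is cancelled exactly; with `σ = +1` the term is `d (w† − w) ≡ 0`, harmless).  The slack slot is left EMPTY
(apply `fillSlack` next, or use `fillCert`). -/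
def fillAntiH (K : SymCert) : SymCert :=
  let K0 : SymCert := { K with slack := [], antiH := [] }
  let R := residualV K0
  let Rdag := canonPipeV K (padj R)
  { K0 with antiH := Rdag.map fun t => (t.1 / 2, [((1 : ℚ), t.2)]) }

/-- **`fillCert = fillSlack ∘ fillAntiH` computed with ONE expensive pass**: the final slack is derived from `R` and
the chosen `antiH` by re-canonicalising only `R − antiHPoly antiH` (cheap), which equals the residual of
`fillAntiH K` whenever the pipeline is additive and idempotent on its own output (it is; and if not, the closing
`symCheckV` simply fails).  Residual words with nonzero particle or spin charge go to the `charged` slot (price `0`,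
`wellFormed` wants exactly `charge ≠ 0` there) instead of `slack` (price `|a|`). -/
def fillCert (K : SymCert) : SymCert :=
  let K0 : SymCert := { K with slack := [], antiH := [] }
  let R := residualV K0
  let Rdag := canonPipeV K (padj R)
  let A : List (ℚ × QPoly) := Rdag.map fun t => (t.1 / 2, [((1 : ℚ), t.2)])
  let S := canonPipeV K (R ++ pscale (-1) (antiHPoly A))
  let CS := S.partition fun t => wordCharge t.2 != 0 || wordSpinCharge t.2 != 0
  { K0 with antiH := A, charged := K0.charged ++ CS.1, slack := CS.2 }

/-- `fillCert` by TWO full passes (reference semantics of `fillSlack ∘ fillAntiH`; slower, for cross-checks). -/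
def fillCert2 (K : SymCert) : SymCert := fillSlack (fillAntiH K)

/-- The `ℓ₁` price of a slack slot. -/
def slackL1 (S : List (ℚ × Word)) : ℚ := (S.map fun t => qabs t.1).sum

/-! ### Kernel / compiled demos on T1's toy certificates -/

/-- The one-bond toy certificate of T1 has zero residual (its identity closes with no slack). -/
example : residualV toyCert = [] := by decide +kernel

/-- `fillCert` of a certificate that already closes is the same certificate up to empty slots: still accepted. -/
example : symCheckV (fillCert toyCanonCert) = true := by native_decide

/-- Perturb the constant of the `useCanon` toy by `+1/7`: the identity no longer closes … -/
example : identityOKV { toyCanonCert with c := toyCanonCert.c + 1/7 } = false := by native_decide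

/-- … `fillCert` repairs it by ONE slack term on the empty word (the identity operator), priced `1/7`, so the
certified value is unchanged: `symValue = (c + 1/7) − 1/7`. -/
example : symCheckV (fillCert { toyCanonCert with c := toyCanonCert.c + 1/7 }) = true ∧
    symValue (fillCert { toyCanonCert with c := toyCanonCert.c + 1/7 }) = symValue toyCanonCert := by
  constructor
  · native_decide
  · native_decide

end Fill

end Summit.Ventures.CertifiedManyBodySolver.Theorems.SymReplay
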